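import Summits.ResolutionOfSingularities.ResolutionOfSingularities.Theorems.FrobeniusLadderFRationalResolutionGaloisTwistChart
import Mathlib.RingTheory.Ideal.Quotient.Operations
import Mathlib.RingTheory.Ideal.Maximal
import HarnessLib

/-!
# Crux `FrobeniusLadder.FRationalResolution` (stmt-ResolutionOfSingularities-15317), line `redirect`,
# stub `stub_diagonalizableQuotientResolution` — chart points ↔ residue embeddings, and the STABILIZER CRITERION
# `σ''(𝔚) = 𝔚 ↔ σ̄ ∘ ι = ι` (item [S–M] of MEMO-15317-leafhand2-g14 §3)

Setting of the Galois route: `B → B'` (in the route `B' = B ⊗_K K'`), the chart `C` over `B`, `C' = B' ⊗_B C`, `𝔔 ⊆ C` and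
`𝔔' ⊆ B'` maximal. A point `𝔚 ⊆ C'` BELONGS TO the ring map `ι : C/𝔔 → B'/𝔔'` when `1 ⊗ c ≡ b' ⊗ 1 (mod 𝔚)` whenever
`b̄' = ι(c̄)`; this is the link between the trivial-residue points of `…TrivialResiduePoint` / `…GaloisUpstairsPieceCover` and the
residue embeddings of `…GaloisResidueEmbedding` that the existing interface forgot (it only exported `𝔚 ∩ B'`, `𝔚 ∩ C`, `hres`).
The relation is spelled out as a hypothesis each time (no definition is introduced).

* `exists_point_belongs` — the point `ker (b' ⊗ c ↦ b̄' ι(c̄))` of `…TrivialResiduePoint`, re-exported WITH the relation: it is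
  maximal, lies over `𝔔'` and `𝔔`, has trivial residue extension over `B'`, and belongs to `ι`.
* `le_of_belongs`, `eq_of_belongs` — a point over `𝔔'` is DETERMINED by the embedding it belongs to.
* `ringHom_eq_of_belongs` — and determines it: a proper point belongs to at most one `ι`.
* `map_chartTwist_belongs` — for `B' = B ⊗_K K'` and `σ` in the decomposition group of `𝔔'` (`(1 ⊗ σ) 𝔔' = 𝔔'`), with
  `σ̄ : B'/𝔔' → B'/𝔔'` the induced automorphism: `𝔚` belongs to `ι` ⇒ `σ''(𝔚)` belongs to `σ̄ ∘ ι`.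
* **`map_chartTwist_eq_iff`** — THE STABILIZER CRITERION: for such `σ` and a point `𝔚` over `𝔔'` belonging to `ι`,
  `σ''(𝔚) = 𝔚 ↔ σ̄ ∘ ι = ι`. Hence the hypothesis `hfix` of ✓ `…GaloisFixedPointPiece` holds iff `ι(κ(𝔔))` is fixed pointwise by
  every `σ̄`, `σ ∈ D` — for an étale chart (separable `κ(𝔔)/κ(𝔭)`) and `K'` large this is the residue-trivial case `κ(𝔔) = κ(𝔭)`
  only; at a genuinely twisted point (`d = [κ(𝔔):κ(𝔭)] ≥ 2`) NO trivial-residue point is fixed by the decomposition group (which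
  acts transitively on them, ✓ `…GaloisChartTransitive`), so no `D`-equivariant choice of point — hence of an unsymmetrized piece —
  exists: the obstruction `hD` is exactly «the piece depends on the point» (✓ `…GaloisPieceOrbit`).

Honest label: plumbing/structure toward ONE leaf stub (no stub, crux or summit closed). No definitions, no named facts, no sorry.
[cite: StacksProject, Tag 00UW; Tag 09EB]
-/

noncomputable section

-- single-problem summit: the doubled namespace component is forced
set_option linter.dupNamespace false

open scoped TensorProduct

namespace Summit.ResolutionOfSingularities.ResolutionOfSingularities.Theorems.FRationalResolution.GaloisResiduePointEmbedding

/-! ### Points and the embeddings they belong to (any `B → B'`) -/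

section general

variable {B B' C : Type} [CommRing B] [CommRing B'] [CommRing C] [Algebra B B'] [Algebra B C]

/-- **The trivial-residue point of an embedding, with its defining relation.** For maximal `𝔔 ⊆ C`, `𝔔' ⊆ B'` and a ring map
`ι : C/𝔔 → B'/𝔔'` compatible with `B`, the ideal `𝔚 = ker (B' ⊗_B C → B'/𝔔', b' ⊗ c ↦ b̄' ι(c̄))` is maximal, lies over `𝔔'`
and over `𝔔`, every element of `B' ⊗_B C` is congruent mod `𝔚` to an element of `B'`, and `𝔚` BELONGS TO `ι`:
`1 ⊗ c - b' ⊗ 1 ∈ 𝔚` whenever `b̄' = ι(c̄)`. (✓ `…TrivialResiduePoint.exists_trivial_residue_point` plus the last clause.)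
[cite: StacksProject, Tag 00UW] -/
theorem exists_point_belongs (𝔔 : Ideal C) [h𝔔 : 𝔔.IsMaximal] (𝔔' : Ideal B') [h𝔔' : 𝔔'.IsMaximal]
    (ι : C ⧸ 𝔔 →+* B' ⧸ 𝔔')
    (hι : ∀ b : B, ι (Ideal.Quotient.mk 𝔔 (algebraMap B C b)) = Ideal.Quotient.mk 𝔔' (algebraMap B B' b)) :
    ∃ (𝔚 : Ideal (B' ⊗[B] C)), 𝔚.IsMaximal ∧
      𝔚.comap (algebraMap B' (B' ⊗[B] C)) = 𝔔' ∧
      𝔚.comap ((Algebra.TensorProduct.includeRight : C →ₐ[B] B' ⊗[B] C) : C →+* B' ⊗[B] C) = 𝔔 ∧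
      (∀ x : B' ⊗[B] C, ∃ b' : B', x - algebraMap B' (B' ⊗[B] C) b' ∈ 𝔚) ∧
      ∀ (c : C) (b' : B'), Ideal.Quotient.mk 𝔔' b' = ι (Ideal.Quotient.mk 𝔔 c) →
        (Algebra.TensorProduct.includeRight : C →ₐ[B] B' ⊗[B] C) c - algebraMap B' (B' ⊗[B] C) b' ∈ 𝔚 := by
  letI : Field (C ⧸ 𝔔) := Ideal.Quotient.field 𝔔
  letI : Field (B' ⧸ 𝔔') := Ideal.Quotient.field 𝔔'
  let f : B' →ₐ[B] B' ⧸ 𝔔' := Ideal.Quotient.mkₐ B 𝔔'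
  let g : C →ₐ[B] B' ⧸ 𝔔' :=
    { toRingHom := ι.comp (Ideal.Quotient.mk 𝔔)
      commutes' := fun b => by
        show ι (Ideal.Quotient.mk 𝔔 (algebraMap B C b)) = algebraMap B (B' ⧸ 𝔔') b
        rw [hι b]
        rfl }
  let Φ : B' ⊗[B] C →ₐ[B] B' ⧸ 𝔔' := Algebra.TensorProduct.lift f g (fun x y => Commute.all _ _)
  have hΦl : ∀ b' : B', Φ (algebraMap B' (B' ⊗[B] C) b') = Ideal.Quotient.mk 𝔔' b' := by
    intro b'
    rw [Algebra.TensorProduct.algebraMap_apply, Algebra.algebraMap_self, RingHom.id_apply]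
    show Φ (b' ⊗ₜ[B] (1 : C)) = _
    rw [Algebra.TensorProduct.lift_tmul, map_one, mul_one]
    rfl
  have hΦr : ∀ c : C, Φ ((Algebra.TensorProduct.includeRight : C →ₐ[B] B' ⊗[B] C) c) =
      ι (Ideal.Quotient.mk 𝔔 c) := by
    intro c
    rw [Algebra.TensorProduct.includeRight_apply, Algebra.TensorProduct.lift_tmul, map_one, one_mul]
    rfl
  have hsurj : Function.Surjective Φ := by
    intro y
    obtain ⟨b', rfl⟩ := Ideal.Quotient.mk_surjective y
    exact ⟨algebraMap B' (B' ⊗[B] C) b', hΦl b'⟩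
  refine ⟨RingHom.ker (Φ : B' ⊗[B] C →+* B' ⧸ 𝔔'), ?_, ?_, ?_, ?_, ?_⟩
  · exact RingHom.ker_isMaximal_of_surjective (Φ : B' ⊗[B] C →+* B' ⧸ 𝔔') hsurj
  · ext b'
    rw [Ideal.mem_comap, RingHom.mem_ker, AlgHom.coe_toRingHom, hΦl, Ideal.Quotient.eq_zero_iff_mem]
  · ext c
    rw [Ideal.mem_comap, RingHom.mem_ker, AlgHom.coe_toRingHom, AlgHom.coe_toRingHom, hΦr,
      map_eq_zero_iff ι ι.injective, Ideal.Quotient.eq_zero_iff_mem]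
  · intro x
    obtain ⟨b', hb'⟩ := Ideal.Quotient.mk_surjective (Φ x)
    refine ⟨b', ?_⟩
    rw [RingHom.mem_ker, map_sub, AlgHom.coe_toRingHom, hΦl, ← hb', sub_self]
  · intro c b' h
    rw [RingHom.mem_ker, map_sub, AlgHom.coe_toRingHom, hΦl, hΦr, h, sub_self]

/-- Points belonging to the same embedding: every element of the chart is congruent to ONE element of `B'` modulo both.
[cite: StacksProject, Tag 00UW] -/
theorem exists_sub_algebraMap_mem_inf (𝔔 : Ideal C) (𝔔' : Ideal B')
    (ι : C ⧸ 𝔔 →+* B' ⧸ 𝔔') (𝔚₁ 𝔚₂ : Ideal (B' ⊗[B] C))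
    (h₁ : ∀ (c : C) (b' : B'), Ideal.Quotient.mk 𝔔' b' = ι (Ideal.Quotient.mk 𝔔 c) →
      (Algebra.TensorProduct.includeRight : C →ₐ[B] B' ⊗[B] C) c - algebraMap B' (B' ⊗[B] C) b' ∈ 𝔚₁)
    (h₂ : ∀ (c : C) (b' : B'), Ideal.Quotient.mk 𝔔' b' = ι (Ideal.Quotient.mk 𝔔 c) →
      (Algebra.TensorProduct.includeRight : C →ₐ[B] B' ⊗[B] C) c - algebraMap B' (B' ⊗[B] C) b' ∈ 𝔚₂)
    (x : B' ⊗[B] C) : ∃ b' : B', x - algebraMap B' (B' ⊗[B] C) b' ∈ 𝔚₁ ⊓ 𝔚₂ := by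
  induction x using TensorProduct.induction_on with
  | zero => exact ⟨0, by rw [map_zero, sub_zero]; exact Ideal.zero_mem _⟩
  | add x y hx hy =>
    obtain ⟨b₁, hb₁⟩ := hx
    obtain ⟨b₂, hb₂⟩ := hy
    refine ⟨b₁ + b₂, ?_⟩
    have : x + y - algebraMap B' (B' ⊗[B] C) (b₁ + b₂) =
        (x - algebraMap B' (B' ⊗[B] C) b₁) + (y - algebraMap B' (B' ⊗[B] C) b₂) := by
      rw [map_add]; ring
    rw [this]
    exact Ideal.add_mem _ hb₁ hb₂
  | tmul b' c =>
    obtain ⟨b'', hb''⟩ := Ideal.Quotient.mk_surjective (ι (Ideal.Quotient.mk 𝔔 c))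
    refine ⟨b' * b'', ?_⟩
    have key : b' ⊗ₜ[B] c - algebraMap B' (B' ⊗[B] C) (b' * b'') =
        algebraMap B' (B' ⊗[B] C) b' *
          ((Algebra.TensorProduct.includeRight : C →ₐ[B] B' ⊗[B] C) c - algebraMap B' (B' ⊗[B] C) b'') := by
      rw [mul_sub, ← map_mul]
      congr 1
      rw [Algebra.TensorProduct.includeRight_apply, Algebra.TensorProduct.algebraMap_apply, Algebra.algebraMap_self,
        RingHom.id_apply, Algebra.TensorProduct.tmul_mul_tmul, mul_one, one_mul]
    rw [key]
    exact Ideal.mul_mem_left _ _ (Ideal.mem_inf.mpr ⟨h₁ c b'' hb'', h₂ c b'' hb''⟩)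

/-- **A point over `𝔔'` is determined by the embedding it belongs to** (inclusion form): if `𝔚₁` contracts into `𝔔'`, `𝔚₂`
contains `𝔔'`, and both belong to `ι`, then `𝔚₁ ≤ 𝔚₂`. [cite: StacksProject, Tag 00UW] -/
theorem le_of_belongs (𝔔 : Ideal C) (𝔔' : Ideal B')
    (ι : C ⧸ 𝔔 →+* B' ⧸ 𝔔') (𝔚₁ 𝔚₂ : Ideal (B' ⊗[B] C))
    (h𝔚₁ : 𝔚₁.comap (algebraMap B' (B' ⊗[B] C)) ≤ 𝔔') (h𝔚₂ : 𝔔'.map (algebraMap B' (B' ⊗[B] C)) ≤ 𝔚₂)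
    (h₁ : ∀ (c : C) (b' : B'), Ideal.Quotient.mk 𝔔' b' = ι (Ideal.Quotient.mk 𝔔 c) →
      (Algebra.TensorProduct.includeRight : C →ₐ[B] B' ⊗[B] C) c - algebraMap B' (B' ⊗[B] C) b' ∈ 𝔚₁)
    (h₂ : ∀ (c : C) (b' : B'), Ideal.Quotient.mk 𝔔' b' = ι (Ideal.Quotient.mk 𝔔 c) →
      (Algebra.TensorProduct.includeRight : C →ₐ[B] B' ⊗[B] C) c - algebraMap B' (B' ⊗[B] C) b' ∈ 𝔚₂) :
    𝔚₁ ≤ 𝔚₂ := by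
  intro x hx
  obtain ⟨b', hb'⟩ := exists_sub_algebraMap_mem_inf 𝔔 𝔔' ι 𝔚₁ 𝔚₂ h₁ h₂ x
  obtain ⟨hb₁, hb₂⟩ := Ideal.mem_inf.mp hb'
  have hb'𝔚₁ : algebraMap B' (B' ⊗[B] C) b' ∈ 𝔚₁ := by
    have := Ideal.sub_mem _ hx hb₁
    rwa [sub_sub_cancel] at this
  have hb'𝔔' : b' ∈ 𝔔' := h𝔚₁ (Ideal.mem_comap.mpr hb'𝔚₁)
  have hb'𝔚₂ : algebraMap B' (B' ⊗[B] C) b' ∈ 𝔚₂ := h𝔚₂ (Ideal.mem_map_of_mem _ hb'𝔔')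
  have := Ideal.add_mem _ hb₂ hb'𝔚₂
  rwa [sub_add_cancel] at this

/-- **A point over `𝔔'` is determined by the embedding it belongs to**: two ideals of the chart contracting to `𝔔'` and belonging
to the same `ι` are equal. [cite: StacksProject, Tag 00UW] -/
theorem eq_of_belongs (𝔔 : Ideal C) (𝔔' : Ideal B')
    (ι : C ⧸ 𝔔 →+* B' ⧸ 𝔔') (𝔚₁ 𝔚₂ : Ideal (B' ⊗[B] C))
    (h𝔚₁ : 𝔚₁.comap (algebraMap B' (B' ⊗[B] C)) = 𝔔') (h𝔚₂ : 𝔚₂.comap (algebraMap B' (B' ⊗[B] C)) = 𝔔')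
    (h₁ : ∀ (c : C) (b' : B'), Ideal.Quotient.mk 𝔔' b' = ι (Ideal.Quotient.mk 𝔔 c) →
      (Algebra.TensorProduct.includeRight : C →ₐ[B] B' ⊗[B] C) c - algebraMap B' (B' ⊗[B] C) b' ∈ 𝔚₁)
    (h₂ : ∀ (c : C) (b' : B'), Ideal.Quotient.mk 𝔔' b' = ι (Ideal.Quotient.mk 𝔔 c) →
      (Algebra.TensorProduct.includeRight : C →ₐ[B] B' ⊗[B] C) c - algebraMap B' (B' ⊗[B] C) b' ∈ 𝔚₂) :
    𝔚₁ = 𝔚₂ :=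
  le_antisymm
    (le_of_belongs 𝔔 𝔔' ι 𝔚₁ 𝔚₂ h𝔚₁.le (by rw [← h𝔚₂]; exact Ideal.map_comap_le) h₁ h₂)
    (le_of_belongs 𝔔 𝔔' ι 𝔚₂ 𝔚₁ h𝔚₂.le (by rw [← h𝔚₁]; exact Ideal.map_comap_le) h₂ h₁)

/-- **A point belongs to at most one embedding**: if `𝔚` contracts into `𝔔'` and belongs to `ι₁` and to `ι₂`, then `ι₁ = ι₂`.
[cite: StacksProject, Tag 00UW] -/
theorem ringHom_eq_of_belongs (𝔔 : Ideal C) (𝔔' : Ideal B')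
    (ι₁ ι₂ : C ⧸ 𝔔 →+* B' ⧸ 𝔔') (𝔚 : Ideal (B' ⊗[B] C))
    (h𝔚 : 𝔚.comap (algebraMap B' (B' ⊗[B] C)) ≤ 𝔔')
    (h₁ : ∀ (c : C) (b' : B'), Ideal.Quotient.mk 𝔔' b' = ι₁ (Ideal.Quotient.mk 𝔔 c) →
      (Algebra.TensorProduct.includeRight : C →ₐ[B] B' ⊗[B] C) c - algebraMap B' (B' ⊗[B] C) b' ∈ 𝔚)
    (h₂ : ∀ (c : C) (b' : B'), Ideal.Quotient.mk 𝔔' b' = ι₂ (Ideal.Quotient.mk 𝔔 c) →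
      (Algebra.TensorProduct.includeRight : C →ₐ[B] B' ⊗[B] C) c - algebraMap B' (B' ⊗[B] C) b' ∈ 𝔚) :
    ι₁ = ι₂ := by
  refine RingHom.ext fun x => ?_
  obtain ⟨c, rfl⟩ := Ideal.Quotient.mk_surjective x
  obtain ⟨b₁, hb₁⟩ := Ideal.Quotient.mk_surjective (ι₁ (Ideal.Quotient.mk 𝔔 c))
  obtain ⟨b₂, hb₂⟩ := Ideal.Quotient.mk_surjective (ι₂ (Ideal.Quotient.mk 𝔔 c))
  have hmem : algebraMap B' (B' ⊗[B] C) (b₂ - b₁) ∈ 𝔚 := by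
    have := Ideal.sub_mem _ (h₁ c b₁ hb₁) (h₂ c b₂ hb₂)
    rwa [sub_sub_sub_cancel_left, ← map_sub] at this
  have h𝔔' : b₂ - b₁ ∈ 𝔔' := h𝔚 (Ideal.mem_comap.mpr hmem)
  rw [← hb₁, ← hb₂]
  exact (Ideal.Quotient.eq.mpr h𝔔').symm

end general

/-! ### The Galois setting: chart twists move the embedding by `σ̄` -/

section galois

variable {K B K' C : Type} [Field K] [CommRing B] [Algebra K B] [Field K'] [Algebra K K'] [CommRing C] [Algebra B C]

/-- For `σ` in the decomposition group of `𝔔'`, `𝔔' ≤ (1 ⊗ σ)⁻¹ 𝔔'` (the input of `Ideal.quotientMap` defining `σ̄`).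
[cite: StacksProject, Tag 09EB] -/
theorem le_comap_twist_of_map_eq (𝔔' : Ideal (B ⊗[K] K')) (σ : K' ≃ₐ[K] K')
    (hσ : 𝔔'.map (Algebra.TensorProduct.map (AlgHom.id B B) (σ : K' →ₐ[K] K')) = 𝔔') :
    𝔔' ≤ 𝔔'.comap (Algebra.TensorProduct.map (AlgHom.id B B) (σ : K' →ₐ[K] K') : B ⊗[K] K' →+* B ⊗[K] K') := by
  rw [← Ideal.map_le_iff_le_comap, Ideal.map_coe, hσ]

/-- **Chart twists move the embedding by `σ̄`.** `B' = B ⊗_K K'`, `C' = B' ⊗_B C`, `𝔔' ⊆ B'` maximal, `σ` with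
`(1 ⊗ σ) 𝔔' = 𝔔'` and `σ̄ : B'/𝔔' → B'/𝔔'` the induced map. If `𝔚 ⊆ C'` lies over `𝔔'` and belongs to `ι : C/𝔔 → B'/𝔔'`,
then `σ''(𝔚)` belongs to `σ̄ ∘ ι`. [cite: StacksProject, Tag 09EB; Tag 00UW] -/
theorem map_chartTwist_belongs (𝔔 : Ideal C) (𝔔' : Ideal (B ⊗[K] K'))
    (ι : C ⧸ 𝔔 →+* (B ⊗[K] K') ⧸ 𝔔') (𝔚 : Ideal ((B ⊗[K] K') ⊗[B] C))
    (h𝔚B : 𝔚.comap (algebraMap (B ⊗[K] K') ((B ⊗[K] K') ⊗[B] C)) = 𝔔')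
    (hι : ∀ (c : C) (b' : B ⊗[K] K'), Ideal.Quotient.mk 𝔔' b' = ι (Ideal.Quotient.mk 𝔔 c) →
      (Algebra.TensorProduct.includeRight : C →ₐ[B] (B ⊗[K] K') ⊗[B] C) c -
        algebraMap (B ⊗[K] K') ((B ⊗[K] K') ⊗[B] C) b' ∈ 𝔚)
    (σ : K' ≃ₐ[K] K') (hσ : 𝔔'.map (Algebra.TensorProduct.map (AlgHom.id B B) (σ : K' →ₐ[K] K')) = 𝔔')
    (c : C) (b' : B ⊗[K] K')
    (h : Ideal.Quotient.mk 𝔔' b' =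
      (Ideal.quotientMap 𝔔' (Algebra.TensorProduct.map (AlgHom.id B B) (σ : K' →ₐ[K] K') : B ⊗[K] K' →+* B ⊗[K] K')
        (le_comap_twist_of_map_eq 𝔔' σ hσ)) (ι (Ideal.Quotient.mk 𝔔 c))) :
    (Algebra.TensorProduct.includeRight : C →ₐ[B] (B ⊗[K] K') ⊗[B] C) c -
        algebraMap (B ⊗[K] K') ((B ⊗[K] K') ⊗[B] C) b' ∈
      𝔚.map (Algebra.TensorProduct.map (Algebra.TensorProduct.map (AlgHom.id B B) (σ : K' →ₐ[K] K'))
        (AlgHom.id B C)) := by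
  -- a lift `b''` of `ι(c̄)`; then `1 ⊗ c - b'' ⊗ 1 ∈ 𝔚`, and `σ''` of it is `1 ⊗ c - (1 ⊗ σ) b'' ⊗ 1 ∈ σ''(𝔚)`
  obtain ⟨b'', hb''⟩ := Ideal.Quotient.mk_surjective (ι (Ideal.Quotient.mk 𝔔 c))
  have h1 : (Algebra.TensorProduct.includeRight : C →ₐ[B] (B ⊗[K] K') ⊗[B] C) c -
      algebraMap (B ⊗[K] K') ((B ⊗[K] K') ⊗[B] C)
        (Algebra.TensorProduct.map (AlgHom.id B B) (σ : K' →ₐ[K] K') b'') ∈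
      𝔚.map (Algebra.TensorProduct.map (Algebra.TensorProduct.map (AlgHom.id B B) (σ : K' →ₐ[K] K'))
        (AlgHom.id B C)) := by
    have hm := Ideal.mem_map_of_mem
      (Algebra.TensorProduct.map (Algebra.TensorProduct.map (AlgHom.id B B) (σ : K' →ₐ[K] K')) (AlgHom.id B C))
      (hι c b'' hb'')
    rwa [map_sub, GaloisTwistChart.chartTwist_includeRight, GaloisTwistChart.chartTwist_algebraMap] at hm
  -- `b' - (1 ⊗ σ) b'' ∈ 𝔔'`, and `𝔔' ⊗ 1 ⊆ σ''(𝔚)` since `σ''(𝔚)` lies over `(1 ⊗ σ) 𝔔' = 𝔔'`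
  have h2 : b' - Algebra.TensorProduct.map (AlgHom.id B B) (σ : K' →ₐ[K] K') b'' ∈ 𝔔' := by
    rw [← Ideal.Quotient.eq, h, ← hb'', Ideal.quotientMap_mk]
    rfl
  have h3 : algebraMap (B ⊗[K] K') ((B ⊗[K] K') ⊗[B] C)
      (b' - Algebra.TensorProduct.map (AlgHom.id B B) (σ : K' →ₐ[K] K') b'') ∈
      𝔚.map (Algebra.TensorProduct.map (Algebra.TensorProduct.map (AlgHom.id B B) (σ : K' →ₐ[K] K'))
        (AlgHom.id B C)) := by
    rw [← Ideal.mem_comap, GaloisTwistChart.comap_algebraMap_map_chartTwist, h𝔚B, hσ]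
    exact h2
  have := Ideal.sub_mem _ h1 h3
  rwa [map_sub, sub_sub_sub_cancel_right] at this

/-- **The stabilizer criterion `σ''(𝔚) = 𝔚 ↔ σ̄ ∘ ι = ι`.** `B' = B ⊗_K K'`, `C' = B' ⊗_B C`, `𝔔' ⊆ B'` maximal, `σ` in the
decomposition group of `𝔔'` with induced `σ̄ : B'/𝔔' → B'/𝔔'`, and `𝔚 ⊆ C'` an ideal over `𝔔'` belonging to
`ι : C/𝔔 → B'/𝔔'`. Then the chart twist `σ''` fixes `𝔚` iff `σ̄ ∘ ι = ι`. [cite: StacksProject, Tag 09EB; Tag 00UW] -/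
theorem map_chartTwist_eq_iff (𝔔 : Ideal C) (𝔔' : Ideal (B ⊗[K] K'))
    (ι : C ⧸ 𝔔 →+* (B ⊗[K] K') ⧸ 𝔔') (𝔚 : Ideal ((B ⊗[K] K') ⊗[B] C))
    (h𝔚B : 𝔚.comap (algebraMap (B ⊗[K] K') ((B ⊗[K] K') ⊗[B] C)) = 𝔔')
    (hι : ∀ (c : C) (b' : B ⊗[K] K'), Ideal.Quotient.mk 𝔔' b' = ι (Ideal.Quotient.mk 𝔔 c) →
      (Algebra.TensorProduct.includeRight : C →ₐ[B] (B ⊗[K] K') ⊗[B] C) c -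
        algebraMap (B ⊗[K] K') ((B ⊗[K] K') ⊗[B] C) b' ∈ 𝔚)
    (σ : K' ≃ₐ[K] K') (hσ : 𝔔'.map (Algebra.TensorProduct.map (AlgHom.id B B) (σ : K' →ₐ[K] K')) = 𝔔') :
    𝔚.map (Algebra.TensorProduct.map (Algebra.TensorProduct.map (AlgHom.id B B) (σ : K' →ₐ[K] K'))
        (AlgHom.id B C)) = 𝔚 ↔
      (Ideal.quotientMap 𝔔' (Algebra.TensorProduct.map (AlgHom.id B B) (σ : K' →ₐ[K] K') : B ⊗[K] K' →+* B ⊗[K] K')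
        (le_comap_twist_of_map_eq 𝔔' σ hσ)).comp ι = ι := by
  have hTwB : (𝔚.map (Algebra.TensorProduct.map (Algebra.TensorProduct.map (AlgHom.id B B) (σ : K' →ₐ[K] K'))
      (AlgHom.id B C))).comap (algebraMap (B ⊗[K] K') ((B ⊗[K] K') ⊗[B] C)) = 𝔔' := by
    rw [GaloisTwistChart.comap_algebraMap_map_chartTwist, h𝔚B, hσ]
  have hTwι := fun c b' h => map_chartTwist_belongs 𝔔 𝔔' ι 𝔚 h𝔚B hι σ hσ c b' h
  constructor
  · intro hfix
    rw [hfix] at hTwι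
    exact ringHom_eq_of_belongs 𝔔 𝔔' _ ι 𝔚 h𝔚B.le (fun c b' h => hTwι c b' (by rw [h, RingHom.comp_apply])) hι
  · intro hcomp
    refine eq_of_belongs 𝔔 𝔔' ι _ 𝔚 hTwB h𝔚B (fun c b' h => hTwι c b' ?_) hι
    rw [h]
    exact (RingHom.congr_fun hcomp (Ideal.Quotient.mk 𝔔 c)).symm

end galois

end Summit.ResolutionOfSingularities.ResolutionOfSingularities.Theorems.FRationalResolution.GaloisResiduePointEmbedding

end
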